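import Summits.CriticalPhenomena.PercolationContinuityZ3.Theorems.Transplant.FKConnectivityAllQAntipodalTwoSpineCells
import Summits.CriticalPhenomena.PercolationContinuityZ3.Theorems.Transplant.FKConnectivityAllQAntipodalTwoSpinePhiRows
import Summits.CriticalPhenomena.PercolationContinuityZ3.Theorems.Transplant.FKConnectivityAllQAntipodalTwoSpineDiag
import Summits.CriticalPhenomena.PercolationContinuityZ3.Theorems.Transplant.FKConnectivityAllQAntipodalX2DualPos
import HarnessLib

/-!
# Two-spine word model of `U¹¹` — WORD DUALITY: the parallel-top root coefficient is the series-top one of the dual words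

Helper file (`--supports stmt-CriticalPhenomena-4575`), FK sub-lane `prim-bschramm-fk-2` (gen 16); builds on p205010 (kernel theorem,
internal audit signed; external expert review pending).  No named facts, no sorries, standard axioms.  Pure word combinatorics.

Memo `bschramm/FROM-fk-2-g15-TWO-SPINE.md` §10.11/§12.3 (parallel split node by word duality) made exact.  Let `σD` be the letter map
`(k, b, b̄) ↦ (k*, ¬b̄, ¬b)` (kind exchanged, bits complemented AND exchanged — gen 14's `dualLetter` followed by `swapLetter`); it
preserves the flip order `01 → 10` and the rows of `σD w` are the kind-exchanged rows of `w` in the opposite order (`sRowA_sdWord`).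
**`theta_P_eq_dual`**: for every word pair,
`q^{2(#series letters of u and v)} · Θ_P(u, v) = q^{1 + #1-bits of u and v} · Θ_W(σD u, σD v)`
(`theta q .P` vs `theta q .W` at the root modes) — machine-found and checked on 342,225 cells (`explore/dualcheck2.py`), proved here
from gen 14's per-row exponent identity `adjP_true_add` (`…X2DualRows`): per side,
`corr(α)+corr(ᾱ)+[headP α] + [rowCdot α] + [rowC ᾱ] + 2·#series = corr(ᾱ*)+corr(α*)+[headP ᾱ*] + 1 + #ones` (`side_dual_identity`),
and the two sides' surplus `[¬(c•(α) ∨ c(β))] - [c(ᾱ) ∨ c•(β̄)]` vanishes exactly when the Janus half does not.  Consequence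
(`…TwoSpineDualRule`): the parallel-top root word inequality follows from the series-top rule theorem by reindexing, hence Conjecture
U¹¹ at PARALLEL split nodes.
[cite: Grimmett2006, §3.9 (p. 63); §6.1 (pp. 133–136)]
-/

noncomputable section

namespace Summit.CriticalPhenomena.PercolationContinuityZ3.Theorems

namespace FK

namespace TwoSpine

open X2Word

/-! ### The flip-order preserving duality `σD` on words -/

/-- The word map `σD`: dual letters (kind exchanged, bits complemented) with the two rows exchanged. [folklore] -/
def sdWord (w : List SLetter) : List SLetter := (w.map dualLetter).map swapLetter

/-- Row `A` of `σD w` is the kind-exchanged row `B` of `w`. [folklore] -/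
theorem sRowA_sdWord (w : List SLetter) : sRowA (sdWord w) = (sRowB w).map Kind.other := by
  rw [sdWord, sRowA_map_swapLetter, sRowB_map_dualLetter]

/-- Row `B` of `σD w` is the kind-exchanged row `A` of `w`. [folklore] -/
theorem sRowB_sdWord (w : List SLetter) : sRowB (sdWord w) = (sRowA w).map Kind.other := by
  rw [sdWord, sRowB_map_swapLetter, sRowA_map_dualLetter]

/-- `σD` letterwise. [folklore] -/
theorem sdWord_eq_map (w : List SLetter) : sdWord w = w.map (fun l => (l.1.other, !l.2.2, !l.2.1)) := by
  rw [sdWord, List.map_map]; rfl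

/-- `σD` is an involution. [folklore] -/
theorem sdWord_sdWord (w : List SLetter) : sdWord (sdWord w) = w := by
  rw [sdWord_eq_map, sdWord_eq_map, List.map_map]
  conv_rhs => rw [← List.map_id w]
  refine List.map_congr_left fun l _ => ?_
  obtain ⟨k, b, bb⟩ := l
  cases k <;> simp [Kind.other]

/-- `σD` maps the flip relation `01 → 10` to itself. [folklore] -/
theorem forall₂_flip_sdWord {w w' : List SLetter}
    (h : List.Forall₂ (fun a b : SLetter => b = a ∨ (a.2 = (false, true) ∧ b = (a.1, true, false))) w w') :
    List.Forall₂ (fun a b : SLetter => b = a ∨ (a.2 = (false, true) ∧ b = (a.1, true, false))) (sdWord w) (sdWord w') := by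
  rw [sdWord_eq_map, sdWord_eq_map]
  induction h with
  | nil => exact List.Forall₂.nil
  | @cons a b w w' hab _ ih =>
    refine List.Forall₂.cons ?_ ih
    rcases hab with rfl | ⟨ha, rfl⟩
    · exact Or.inl rfl
    · obtain ⟨k, x, y⟩ := a
      simp only [Prod.mk.injEq] at ha
      obtain ⟨rfl, rfl⟩ := ha
      exact Or.inr ⟨rfl, rfl⟩

/-- The kind sequence of `σD w` is the exchanged kind sequence. [folklore] -/
theorem map_fst_sdWord (w : List SLetter) : (sdWord w).map (·.1) = (w.map (·.1)).map Kind.other := by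
  rw [sdWord_eq_map, List.map_map, List.map_map]; rfl

/-- `#1-bits` is invariant under `σD`'s row exchange and counts complements under duality: not needed; what is needed is that
`onesCount` and `seriesCount` are flip invariants (`…X2DualRows`). For the reindexing we record `sdWord` on `kindWords`. [folklore] -/
theorem sdWord_mem_kindWords {o : List Kind} {w : List SLetter} (hw : w ∈ kindWords o) : sdWord w ∈ kindWords (o.map Kind.other) := by
  rw [mem_kindWords] at hw ⊢
  rw [map_fst_sdWord, hw]

/-! ### Rows under kind exchange -/

/-- `c` of the exchanged row is `¬c•` of the row. [folklore] -/
theorem rowC_map_other (l : List Kind) : rowC (l.map Kind.other) = !rowCdot l := by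
  rw [rowC, lastP_map_other, lastFlag_true_eq_rowCdot]

/-- `c•` of the exchanged row is `¬c` of the row. [folklore] -/
theorem rowCdot_map_other (l : List Kind) : rowCdot (l.map Kind.other) = !rowC l := by
  cases l with
  | nil => rfl
  | cons a l =>
    rw [rowCdot, lastP_map_other, lastFlag_of_ne_nil _ (List.cons_ne_nil _ _), rowC]
    simp

/-- Exchanging kinds swaps the counts of particles and walls. [folklore] -/
theorem count_P_map_other (l : List Kind) : (l.map Kind.other).count Kind.P = l.count Kind.W := by
  induction l with
  | nil => rfl
  | cons a l ih =>
    rw [List.map_cons, List.count_cons, List.count_cons, ih]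
    cases a <;> simp [Kind.other]

/-- Exactly one of: the row is empty, it starts with a particle, its kind exchange starts with a particle. [folklore] -/
theorem headP_add_headP_map_other (l : List Kind) :
    (if headP l then 1 else 0) + (if headP (l.map Kind.other) then 1 else 0) + (if l.isEmpty then 1 else 0 : ℕ) = 1 := by
  cases l with
  | nil => rfl
  | cons a l => cases a <;> rfl

/-- `δ` through the particle indicator of the first object. [folklore] -/
theorem rowDel_add_headP (l : List Kind) : rowDel l + (if headP l then 1 else 0) = 1 := by
  unfold rowDel; cases headP l <;> rfl

/-- `c•` through `c` and emptiness. [folklore] -/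
theorem rowCdot_indicator (l : List Kind) :
    (if rowCdot l then 1 else 0 : ℕ) = (if rowC l then 1 else 0) + (if l.isEmpty then 1 else 0) := by
  cases l with
  | nil => rfl
  | cons a l => simp [rowCdot, rowC]

/-- **The per-row exponent identity under kind exchange** (from gen 14's `adjP_true_add`):
`corr(l) + [headP l] + [c•(l)] + #W(l) = corr(l*) + #P(l) + 1`. [folklore] -/
theorem rowCorr_map_other_identity (l : List Kind) :
    rowCorr l + (if headP l then 1 else 0) + (if rowCdot l then 1 else 0) + l.count Kind.W =
      rowCorr (l.map Kind.other) + l.count Kind.P + 1 := by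
  have h1 := adjP_add_runsP (l.map Kind.other)
  have h2 := adjP_true_add l
  have h3 := adjP_true_eq l
  rw [count_P_map_other] at h1
  rw [lastFlag_true_eq_rowCdot] at h2
  unfold rowCorr
  omega

/-! ### The side identity -/

/-- Walls and particles of the two rows: `#W + #ones = #P + 2·#series` (the walls are the particles of the dual word). [folklore] -/
theorem count_W_rows (u : List SLetter) :
    (sRowA u).count Kind.W + (sRowB u).count Kind.W + onesCount u = (sRowA u).count Kind.P + (sRowB u).count Kind.P + 2 * seriesCount u := by
  have h := nP_add_two_mul_seriesCount u
  simp only [nP, sRowA_map_dualLetter, sRowB_map_dualLetter, count_P_map_other] at h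
  omega

/-- **Side identity** (root face in the `γ`-row `α`): `corr(α)+corr(ᾱ)+[headP α] + [c•(α)] + [c(ᾱ)] + 2·#series(u)
= corr(ᾱ*)+corr(α*)+[headP ᾱ*] + 1 + #ones(u)`. [folklore] -/
theorem side_dual_identity (u : List SLetter) :
    rowCorr (sRowA u) + rowCorr (sRowB u) + (if headP (sRowA u) then 1 else 0) +
        (if rowCdot (sRowA u) then 1 else 0) + (if rowC (sRowB u) then 1 else 0) + 2 * seriesCount u =
      rowCorr ((sRowB u).map Kind.other) + rowCorr ((sRowA u).map Kind.other) +
        (if headP ((sRowB u).map Kind.other) then 1 else 0) + 1 + onesCount u := by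
  have hA := rowCorr_map_other_identity (sRowA u)
  have hB := rowCorr_map_other_identity (sRowB u)
  have hW := count_W_rows u
  have hh := headP_add_headP_map_other (sRowB u)
  have hc := rowCdot_indicator (sRowB u)
  omega

/-- The side identity with the roles of the two rows exchanged (root face in the `γᶜ`-row). [folklore] -/
theorem side_dual_identity' (u : List SLetter) :
    rowCorr (sRowA u) + rowCorr (sRowB u) + (if headP (sRowB u) then 1 else 0) +
        (if rowCdot (sRowB u) then 1 else 0) + (if rowC (sRowA u) then 1 else 0) + 2 * seriesCount u =
      rowCorr ((sRowB u).map Kind.other) + rowCorr ((sRowA u).map Kind.other) +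
        (if headP ((sRowA u).map Kind.other) then 1 else 0) + 1 + onesCount u := by
  have h := side_dual_identity (u.map swapLetter)
  rw [sRowA_map_swapLetter, sRowB_map_swapLetter, seriesCount_map_swapLetter, onesCount_map_swapLetter] at h
  omega

/-! ### The duality identity for the root coefficient -/

/-- Open-mode connection of a kind-exchanged row (real form). [folklore] -/
theorem conn_o_map_other (l : List Kind) : Mode.o.conn (l.map Kind.other) = 1 - Mode.o.connDot l := by
  rw [Mode.conn_o, rowC_map_other, show Mode.o.connDot l = if rowCdot l then 1 else 0 from rfl]
  cases rowCdot l <;> simp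

/-- Open-mode dotted connection of a kind-exchanged row (real form). [folklore] -/
theorem connDot_o_map_other (l : List Kind) : Mode.o.connDot (l.map Kind.other) = 1 - Mode.o.conn l := by
  rw [Mode.conn_o, show Mode.o.connDot (l.map Kind.other) = if rowCdot (l.map Kind.other) then 1 else 0 from rfl,
    rowCdot_map_other]
  cases rowC l <;> simp

/-- Regrouping powers (no correction factor). [folklore] -/
theorem pow_regroup₁ (q : ℝ) {S X e O X' e' : ℕ} (h : 2 * S + X + e = 1 + O + X' + e') :
    q ^ (2 * S) * (q ^ X * q ^ e) = q ^ (1 + O) * (q ^ X' * q ^ e') := by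
  rw [← pow_add, ← pow_add, ← pow_add, ← pow_add, show 2 * S + (X + e) = 1 + O + (X' + e') by omega]

/-- Regrouping powers (one correction factor `q`). [folklore] -/
theorem pow_regroup₂ (q : ℝ) {S X e O X' e' : ℕ} (h : 2 * S + X + e + 1 = 1 + O + X' + e') :
    q ^ (2 * S) * (q ^ X * (q ^ e * q)) = q ^ (1 + O) * (q ^ X' * q ^ e') := by
  rw [← pow_succ, ← pow_add, ← pow_add, ← pow_add, ← pow_add, show 2 * S + (X + (e + 1)) = 1 + O + (X' + e') by omega]

/-- The algebra of one Janus half under duality: a 16-case Boolean identity given the side bookkeeping. [folklore] -/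
theorem half_dual (q : ℝ) {S O X X' e e' : ℕ} (iA iB jA jB : Bool)
    (hside : X + e + (if iA then 1 else 0) + (if jA then 1 else 0) + (if iB then 1 else 0) + (if jB then 1 else 0) + 2 * S =
      X' + e' + 2 + O) :
    q ^ (2 * S) * (q ^ X * (q ^ e * (q ^ (if bR iA * bR iB = 1 then 1 else 0 : ℕ) * q ^ (if bR jA * bR jB = 1 then 1 else 0 : ℕ)) *
        ((bR iA + bR iB - bR iA * bR iB) - (bR jA + bR jB - bR jA * bR jB)))) =
      q ^ (1 + O) * (q ^ X' * (q ^ e' * ((1 - bR jA) * (1 - bR jB) - (1 - bR iA) * (1 - bR iB)))) := by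
  cases iA <;> cases iB <;> cases jA <;> cases jB <;> norm_num [bR] at hside ⊢ <;>
    first | exact pow_regroup₁ q (by omega) | exact pow_regroup₂ q (by omega)

/-- **WORD DUALITY FOR THE ROOT COEFFICIENT**: `q^{2(#series letters)} · Θ_P(u, v) = q^{1 + #1-bits} · Θ_W(σD u, σD v)`. [folklore] -/
theorem theta_P_eq_dual (q : ℝ) (u v : List SLetter) :
    q ^ (2 * (seriesCount u + seriesCount v)) * theta q .P (Mode.o, Mode.o, Mode.o, Mode.o) u v =
      q ^ (1 + (onesCount u + onesCount v)) * theta q .W (Mode.o, Mode.o, Mode.o, Mode.o) (sdWord u) (sdWord v) := by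
  have hP : theta q .P (Mode.o, Mode.o, Mode.o, Mode.o) u v =
      q ^ baseExp (Mode.o, Mode.o, Mode.o, Mode.o) u v *
        (q ^ (2 - rowDel (sRowA u) - rowDel (sRowB v)) *
            (q ^ (if bR (rowCdot (sRowA u)) * bR (rowC (sRowA v)) = 1 then 1 else 0 : ℕ) *
              q ^ (if bR (rowC (sRowB u)) * bR (rowCdot (sRowB v)) = 1 then 1 else 0 : ℕ)) *
            ((bR (rowCdot (sRowA u)) + bR (rowC (sRowA v)) - bR (rowCdot (sRowA u)) * bR (rowC (sRowA v))) -
              (bR (rowC (sRowB u)) + bR (rowCdot (sRowB v)) - bR (rowC (sRowB u)) * bR (rowCdot (sRowB v)))) +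
          q ^ (2 - rowDel (sRowB u) - rowDel (sRowA v)) *
            (q ^ (if bR (rowC (sRowA u)) * bR (rowCdot (sRowA v)) = 1 then 1 else 0 : ℕ) *
              q ^ (if bR (rowCdot (sRowB u)) * bR (rowC (sRowB v)) = 1 then 1 else 0 : ℕ)) *
            ((bR (rowC (sRowA u)) + bR (rowCdot (sRowA v)) - bR (rowC (sRowA u)) * bR (rowCdot (sRowA v))) -
              (bR (rowCdot (sRowB u)) + bR (rowC (sRowB v)) - bR (rowCdot (sRowB u)) * bR (rowC (sRowB v))))) := rfl
  have hW : theta q .W (Mode.o, Mode.o, Mode.o, Mode.o) (sdWord u) (sdWord v) =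
      q ^ baseExp (Mode.o, Mode.o, Mode.o, Mode.o) (sdWord u) (sdWord v) *
        (q ^ (2 - Mode.o.del (sRowA (sdWord u)) - Mode.o.del (sRowB (sdWord v))) *
            (Mode.o.connDot (sRowA (sdWord u)) * Mode.o.conn (sRowA (sdWord v)) -
              Mode.o.conn (sRowB (sdWord u)) * Mode.o.connDot (sRowB (sdWord v))) +
          q ^ (2 - Mode.o.del (sRowB (sdWord u)) - Mode.o.del (sRowA (sdWord v))) *
            (Mode.o.conn (sRowA (sdWord u)) * Mode.o.connDot (sRowA (sdWord v)) -
              Mode.o.connDot (sRowB (sdWord u)) * Mode.o.conn (sRowB (sdWord v)))) := rfl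
  rw [hP, hW, baseExp_root, baseExp_root, sRowA_sdWord u, sRowA_sdWord v, sRowB_sdWord u, sRowB_sdWord v]
  simp only [conn_o_map_other, connDot_o_map_other]
  simp only [Mode.del, Mode.conn_o, show ∀ l, Mode.o.connDot l = if rowCdot l then 1 else 0 from fun _ => rfl, bR]
  -- the side bookkeeping
  have sA := side_dual_identity u
  have sA' := side_dual_identity' u
  have sB := side_dual_identity v
  have sB' := side_dual_identity' v
  have dA := rowDel_add_headP (sRowA u)
  have dA' := rowDel_add_headP (sRowB u)
  have dB := rowDel_add_headP (sRowA v)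
  have dB' := rowDel_add_headP (sRowB v)
  have eA := rowDel_add_headP ((sRowB u).map Kind.other)
  have eA' := rowDel_add_headP ((sRowA u).map Kind.other)
  have eB := rowDel_add_headP ((sRowA v).map Kind.other)
  have eB' := rowDel_add_headP ((sRowB v).map Kind.other)
  have H1 := half_dual q (S := seriesCount u + seriesCount v) (O := onesCount u + onesCount v)
    (X := rowCorr (sRowA u) + rowCorr (sRowB u) + rowCorr (sRowA v) + rowCorr (sRowB v))
    (X' := rowCorr ((sRowB u).map Kind.other) + rowCorr ((sRowA u).map Kind.other) +
      rowCorr ((sRowB v).map Kind.other) + rowCorr ((sRowA v).map Kind.other))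
    (e := 2 - rowDel (sRowA u) - rowDel (sRowB v)) (e' := 2 - rowDel ((sRowB u).map Kind.other) - rowDel ((sRowA v).map Kind.other))
    (rowCdot (sRowA u)) (rowC (sRowA v)) (rowC (sRowB u)) (rowCdot (sRowB v)) (by omega)
  have H2 := half_dual q (S := seriesCount u + seriesCount v) (O := onesCount u + onesCount v)
    (X := rowCorr (sRowA u) + rowCorr (sRowB u) + rowCorr (sRowA v) + rowCorr (sRowB v))
    (X' := rowCorr ((sRowB u).map Kind.other) + rowCorr ((sRowA u).map Kind.other) +
      rowCorr ((sRowB v).map Kind.other) + rowCorr ((sRowA v).map Kind.other))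
    (e := 2 - rowDel (sRowB u) - rowDel (sRowA v)) (e' := 2 - rowDel ((sRowA u).map Kind.other) - rowDel ((sRowB v).map Kind.other))
    (rowC (sRowA u)) (rowCdot (sRowA v)) (rowCdot (sRowB u)) (rowC (sRowB v)) (by omega)
  simp only [bR] at H1 H2
  have split : ∀ a b x y : ℝ, a * (b * (x + y)) = a * (b * x) + a * (b * y) := by intros; ring
  rw [split, split, H1, H2]

end TwoSpine

end FK

end Summit.CriticalPhenomena.PercolationContinuityZ3.Theorems

end
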